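import Mathlib
import Summits.Ventures.PercRepro2.Defs
import Summits.Ventures.PercRepro2.Harris
import Summits.Ventures.PercRepro2.Independence
import Summits.Ventures.PercRepro2.CoinDefs
import Summits.Ventures.PercRepro2.CoinReverse
import Summits.Ventures.PercRepro2.CoinStarDefs
import Summits.Ventures.PercRepro2.CoinLsmCoreDefs
import Summits.Ventures.PercRepro2.CoinLsmCoreU
import Summits.Ventures.PercRepro2.CoinCoreGate
import Summits.Ventures.PercRepro2.CoinTreeCore
import Summits.Ventures.PercRepro2.CoinTreeAncestor
import Summits.Ventures.PercRepro2.CoinOrTailAlg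
import Summits.Ventures.PercRepro2.CoinOrTailDefs
import Summits.Ventures.PercRepro2.CoinOrTailLsmDefs
import Summits.Ventures.PercRepro2.CoinOrTailLsmSums
import Summits.Ventures.PercRepro2.CoinOrTailBlockAlg
import Summits.Ventures.PercRepro2.CoinOrTailBlockSums
import Summits.Ventures.PercRepro2.CoinOrTailMixLsm
import Summits.Ventures.PercRepro2.CoinBlockTheoremII
import Summits.Ventures.PercRepro2.CoinBlockMeanOrder
import Summits.Ventures.PercRepro2.CoinLsmCoreSure
import Summits.Ventures.PercRepro2.CoinOrTailKDefs
import Summits.Ventures.PercRepro2.CoinOrTailKSums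
import Summits.Ventures.PercRepro2.CoinOrTailKAlg
import Summits.Ventures.PercRepro2.CoinOrTailCovCore
import Summits.Ventures.PercRepro2.CoinOrTailKCore
import Summits.Ventures.PercRepro2.CoinMixBlock
import Summits.Ventures.PercRepro2.CoinOrTailKOneAlg
import Summits.Ventures.PercRepro2.CoinOrTailKChainAlg

/-!
# The k-entry OR-tail with a CHAIN of uncovered entries: the functional (blind cell PercRepro2,
night-2 g11; proofs/NIGHT2-DARC.md §45)

`orTailKChain_functional_nonneg`: the cleared gate functional of an OR-tail with the entry set
`ent` on a log-supermodular core, for two markers covering every entry outside a set `und ⊆ ent`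
whose traces on the clusters of positive weight form a CHAIN (`hchain`: for two such clusters one
trace contains the other — e.g. all of `und` on one root path of an out-tree), is nonnegative.
Split every cluster by the OR of the coins of `und` (`rValK_split_sdiff`, `gValK_split_sdiff`): the
CLOSED part is the OR-tail with the entry set `ent \ und` — a covered block system `(L, M)`
(`M₀₀ = Λ₀₀`, `H1`, `H2`) — and the OPEN part has the tail surely entered — a sure block system
`(K, N)`, log-supermodular BECAUSE of the chain hypothesis (the open factor `1 − tailWtK und` is
log-supermodular exactly on nested pairs), and in the block Holley order above `L` and `K`.  Every
block relation is a single Ahlswede–Daykin step (`cellBlock_mul_le`) on a pointwise lattice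
inequality (`three_step`: core law × coin factor × value); the mixed block theorem
`mixBlock_nonneg` closes.  The single uncovered entry of §43 is the case `und = {r₀}`.
-/


namespace Summit.Ventures.PercRepro2.Coin

open Classical

section ThreeStep

variable {R : Type*} [Field R] [LinearOrder R] [IsStrictOrderedRing R]

/-- Three lattice steps (core law, coin factor, value) multiply. -/
lemma three_step {n1 n2 n3 n4 c1 c2 c3 c4 v1 v2 v3 v4 : R}
    (hn : n1 * n2 ≤ n3 * n4) (hc : c1 * c2 ≤ c3 * c4) (hv : v1 * v2 ≤ v3 * v4)
    (hn3 : 0 ≤ n3) (hn4 : 0 ≤ n4) (hc1 : 0 ≤ c1) (hc2 : 0 ≤ c2) (hc3 : 0 ≤ c3) (hc4 : 0 ≤ c4)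
    (hv1 : 0 ≤ v1) (hv2 : 0 ≤ v2) :
    n1 * c1 * v1 * (n2 * c2 * v2) ≤ n3 * c3 * v3 * (n4 * c4 * v4) := by
  have h1 : c1 * c2 * (v1 * v2) ≤ c3 * c4 * (v3 * v4) :=
    mul_le_mul hc hv (mul_nonneg hv1 hv2) (mul_nonneg hc3 hc4)
  have h2 : n1 * n2 * (c1 * c2 * (v1 * v2)) ≤ n3 * n4 * (c3 * c4 * (v3 * v4)) :=
    mul_le_mul hn h1 (mul_nonneg (mul_nonneg hc1 hc2) (mul_nonneg hv1 hv2)) (mul_nonneg hn3 hn4)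
  calc n1 * c1 * v1 * (n2 * c2 * v2) = n1 * n2 * (c1 * c2 * (v1 * v2)) := by ring
    _ ≤ n3 * n4 * (c3 * c4 * (v3 * v4)) := h2
    _ = n3 * c3 * v3 * (n4 * c4 * v4) := by ring

end ThreeStep

section KOneFunctional

variable {V : Type*} {E : Type*} [Fintype V] [DecidableEq V] {R : Type*} [Field R] [LinearOrder R]
  [IsStrictOrderedRing R]

/-- **THE OR-TAIL FUNCTIONAL IS NONNEGATIVE WITH A CHAIN OF UNCOVERED ENTRIES** (the mixed block
theorem on the split by the OR of the coins of `und`). -/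
theorem orTailKChain_functional_nonneg (U : Finset V) (ν A : Finset V → R) (pr : E → R)
    (ent : Finset V) (c : V → E) (m₁ m₂ a w : V) {und : Finset V} (hund : und ⊆ ent)
    (hp0 : ∀ e, 0 ≤ pr e) (hp1 : ∀ e, pr e ≤ 1)
    (hν0 : ∀ W, 0 ≤ ν W) (hν : ∀ s ⊆ U, ∀ t ⊆ U, ν s * ν t ≤ ν (s ∩ t) * ν (s ∪ t))
    (hcov : ∀ W ⊆ U, m₁ ∉ W → m₂ ∉ W → (∃ r ∈ ent \ und, r ∈ W) → ν W = 0)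
    (hchain : ∀ S ⊆ U, ∀ T ⊆ U, ν S ≠ 0 → ν T ≠ 0 →
      (∀ r ∈ und, r ∈ S → r ∈ T) ∨ (∀ r ∈ und, r ∈ T → r ∈ S))
    (hA0 : ∀ W, 0 ≤ A W) (hA : ∀ s t : Finset V, A s * A t ≤ A (s ∩ t) * A (s ∪ t))
    (hmono : ∀ s t : Finset V, s ⊆ t → A t ≤ A s) :
    0 ≤ (∑ W ∈ U.powerset, ν W * rValK A pr ent c a W) ^ 2 *
          (∑ W ∈ U.powerset, ν W * gValK A pr ent c a w W *
            ((if m₁ ∈ W then (1 : R) else 0) * (if m₂ ∈ W then (1 : R) else 0)))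
        - (∑ W ∈ U.powerset, ν W * rValK A pr ent c a W) *
          (∑ W ∈ U.powerset, ν W * rValK A pr ent c a W * (if m₁ ∈ W then (1 : R) else 0)) *
          (∑ W ∈ U.powerset, ν W * gValK A pr ent c a w W * (if m₂ ∈ W then (1 : R) else 0))
        - (∑ W ∈ U.powerset, ν W * rValK A pr ent c a W) *
          (∑ W ∈ U.powerset, ν W * rValK A pr ent c a W * (if m₂ ∈ W then (1 : R) else 0)) *
          (∑ W ∈ U.powerset, ν W * gValK A pr ent c a w W * (if m₁ ∈ W then (1 : R) else 0))
        + (∑ W ∈ U.powerset, ν W * rValK A pr ent c a W * (if m₁ ∈ W then (1 : R) else 0)) *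
          (∑ W ∈ U.powerset, ν W * rValK A pr ent c a W * (if m₂ ∈ W then (1 : R) else 0)) *
          (∑ W ∈ U.powerset, ν W * gValK A pr ent c a w W) := by
  -- the covered entry set and the two coin factors of `und`
  set ent' := ent \ und with hent'
  set cC : Finset V → R := fun W => tailWtK pr und c W with hcC
  set cO : Finset V → R := fun W => 1 - tailWtK pr und c W with hcO
  have hcC0 : ∀ W, 0 ≤ cC W := fun W => tailWtK_nonneg hp1 und c W
  have hcO0 : ∀ W, 0 ≤ cO W := fun W => open_nonneg hp0 hp1 und c W
  -- the four value functions
  set vC : Finset V → R := fun W => rValK A pr ent' c a W with hvC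
  set gC : Finset V → R := fun W => gValK A pr ent' c a w W with hgC
  set vO : Finset V → R := fun W => A (W ∪ {a}) with hvO
  set gO : Finset V → R := fun W => A (W ∪ {a, w}) with hgO
  have hvC0 : ∀ W, 0 ≤ vC W := fun W => rValK_nonneg hp0 hp1 hA0 ent' c a W
  have hgC0 : ∀ W, 0 ≤ gC W := fun W => gValK_nonneg hp0 hp1 hA0 ent' c a w W
  have hvO0 : ∀ W, 0 ≤ vO W := fun W => hA0 _
  have hgO0 : ∀ W, 0 ≤ gO W := fun W => hA0 _
  have hgvC : ∀ W, gC W ≤ vC W := fun W => gValK_le_rValK hp0 hp1 hmono ent' c a w W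
  have haw : ({a} : Finset V) ⊆ {a, w} :=
    Finset.singleton_subset_iff.2 (Finset.mem_insert_self a {w})
  -- the pointwise splits
  have hsplitR : ∀ W, ν W * rValK A pr ent c a W = ν W * cC W * vC W + ν W * cO W * vO W := by
    intro W
    simp only [hcC, hcO, hvC, hvO]
    rw [rValK_split_sdiff A pr c a hund W]
    ring
  have hsplitG : ∀ W, ν W * gValK A pr ent c a w W = ν W * cC W * gC W + ν W * cO W * gO W := by
    intro W
    simp only [hcC, hcO, hgC, hgO]
    rw [gValK_split_sdiff A pr c a w hund W]
    ring
  -- the seven sums split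
  have eR0 : ∑ W ∈ U.powerset, ν W * rValK A pr ent c a W =
      ∑ W ∈ U.powerset, ν W * cC W * vC W + ∑ W ∈ U.powerset, ν W * cO W * vO W := by
    rw [← Finset.sum_add_distrib]
    exact Finset.sum_congr rfl fun W _ => hsplitR W
  have eR1 : ∑ W ∈ U.powerset, ν W * rValK A pr ent c a W * (if m₁ ∈ W then (1 : R) else 0) =
      ∑ W ∈ U.powerset, ν W * cC W * vC W * (if m₁ ∈ W then (1 : R) else 0) +
        ∑ W ∈ U.powerset, ν W * cO W * vO W * (if m₁ ∈ W then (1 : R) else 0) := by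
    rw [← Finset.sum_add_distrib]
    exact Finset.sum_congr rfl fun W _ => by rw [hsplitR W]; ring
  have eR2 : ∑ W ∈ U.powerset, ν W * rValK A pr ent c a W * (if m₂ ∈ W then (1 : R) else 0) =
      ∑ W ∈ U.powerset, ν W * cC W * vC W * (if m₂ ∈ W then (1 : R) else 0) +
        ∑ W ∈ U.powerset, ν W * cO W * vO W * (if m₂ ∈ W then (1 : R) else 0) := by
    rw [← Finset.sum_add_distrib]
    exact Finset.sum_congr rfl fun W _ => by rw [hsplitR W]; ring
  have eG0 : ∑ W ∈ U.powerset, ν W * gValK A pr ent c a w W =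
      ∑ W ∈ U.powerset, ν W * cC W * gC W + ∑ W ∈ U.powerset, ν W * cO W * gO W := by
    rw [← Finset.sum_add_distrib]
    exact Finset.sum_congr rfl fun W _ => hsplitG W
  have eG1 : ∑ W ∈ U.powerset, ν W * gValK A pr ent c a w W * (if m₁ ∈ W then (1 : R) else 0) =
      ∑ W ∈ U.powerset, ν W * cC W * gC W * (if m₁ ∈ W then (1 : R) else 0) +
        ∑ W ∈ U.powerset, ν W * cO W * gO W * (if m₁ ∈ W then (1 : R) else 0) := by
    rw [← Finset.sum_add_distrib]
    exact Finset.sum_congr rfl fun W _ => by rw [hsplitG W]; ring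
  have eG2 : ∑ W ∈ U.powerset, ν W * gValK A pr ent c a w W * (if m₂ ∈ W then (1 : R) else 0) =
      ∑ W ∈ U.powerset, ν W * cC W * gC W * (if m₂ ∈ W then (1 : R) else 0) +
        ∑ W ∈ U.powerset, ν W * cO W * gO W * (if m₂ ∈ W then (1 : R) else 0) := by
    rw [← Finset.sum_add_distrib]
    exact Finset.sum_congr rfl fun W _ => by rw [hsplitG W]; ring
  have eG12 : ∑ W ∈ U.powerset, ν W * gValK A pr ent c a w W *
      ((if m₁ ∈ W then (1 : R) else 0) * (if m₂ ∈ W then (1 : R) else 0)) =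
      ∑ W ∈ U.powerset, ν W * cC W * gC W *
        ((if m₁ ∈ W then (1 : R) else 0) * (if m₂ ∈ W then (1 : R) else 0)) +
        ∑ W ∈ U.powerset, ν W * cO W * gO W *
          ((if m₁ ∈ W then (1 : R) else 0) * (if m₂ ∈ W then (1 : R) else 0)) := by
    rw [← Finset.sum_add_distrib]
    exact Finset.sum_congr rfl fun W _ => by rw [hsplitG W]; ring
  rw [eR0, eR1, eR2, eG0, eG1, eG2, eG12]
  -- the four weight functions and their nonnegativity
  have hLw0 : ∀ W, 0 ≤ ν W * cC W * vC W := fun W =>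
    mul_nonneg (mul_nonneg (hν0 W) (hcC0 W)) (hvC0 W)
  have hMw0 : ∀ W, 0 ≤ ν W * cC W * gC W := fun W =>
    mul_nonneg (mul_nonneg (hν0 W) (hcC0 W)) (hgC0 W)
  have hKw0 : ∀ W, 0 ≤ ν W * cO W * vO W := fun W =>
    mul_nonneg (mul_nonneg (hν0 W) (hcO0 W)) (hvO0 W)
  have hNw0 : ∀ W, 0 ≤ ν W * cO W * gO W := fun W =>
    mul_nonneg (mul_nonneg (hν0 W) (hcO0 W)) (hgO0 W)
  -- the pointwise lattice steps
  have pLL : ∀ s ⊆ U, ∀ t ⊆ U, ν s * cC s * vC s * (ν t * cC t * vC t) ≤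
      ν (s ∩ t) * cC (s ∩ t) * vC (s ∩ t) * (ν (s ∪ t) * cC (s ∪ t) * vC (s ∪ t)) := by
    intro s hs t ht
    exact three_step (hν s hs t ht) (le_of_eq (tailWtK_mul_eq pr und c s t))
      (rValK_mul_le_all A pr ent' c a hp0 hp1 hA0 hA hmono s t) (hν0 _) (hν0 _) (hcC0 _) (hcC0 _)
      (hcC0 _) (hcC0 _) (hvC0 _) (hvC0 _)
  have pMM : ∀ s ⊆ U, ∀ t ⊆ U, ν s * cC s * gC s * (ν t * cC t * gC t) ≤
      ν (s ∩ t) * cC (s ∩ t) * vC (s ∩ t) * (ν (s ∪ t) * cC (s ∪ t) * gC (s ∪ t)) := by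
    intro s hs t ht
    exact three_step (hν s hs t ht) (le_of_eq (tailWtK_mul_eq pr und c s t))
      (gValK_mul_le_rValK_gValK_all A pr ent' c a w hp0 hp1 hA0 hA hmono s t) (hν0 _) (hν0 _)
      (hcC0 _) (hcC0 _) (hcC0 _) (hcC0 _) (hgC0 _) (hgC0 _)
  have pLK : ∀ s ⊆ U, ∀ t ⊆ U, ν s * cC s * vC s * (ν t * cO t * vO t) ≤
      ν (s ∩ t) * cC (s ∩ t) * vC (s ∩ t) * (ν (s ∪ t) * cO (s ∪ t) * vO (s ∪ t)) := by
    intro s hs t ht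
    exact three_step (hν s hs t ht) (closed_mul_open_le' hp0 hp1 und c s t)
      (mixVal_mul_sure_le hp0 hp1 hA0 hA hmono ent' c (Finset.Subset.refl {a}) s t) (hν0 _) (hν0 _)
      (hcC0 _) (hcO0 _) (hcC0 _) (hcO0 _) (hvC0 _) (hvO0 _)
  have pKK : ∀ s ⊆ U, ∀ t ⊆ U, ν s * cO s * vO s * (ν t * cO t * vO t) ≤
      ν (s ∩ t) * cO (s ∩ t) * vO (s ∩ t) * (ν (s ∪ t) * cO (s ∪ t) * vO (s ∪ t)) := by
    intro s hs t ht
    by_cases h0 : ν s = 0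
    · rw [h0]; simp only [zero_mul]; exact mul_nonneg (hKw0 _) (hKw0 _)
    by_cases h1 : ν t = 0
    · rw [h1]; simp only [zero_mul, mul_zero]; exact mul_nonneg (hKw0 _) (hKw0 _)
    exact three_step (hν s hs t ht) (open_mul_open_le_of_chain pr und c (hchain s hs t ht h0 h1))
      (sure_mul_sure_le hA0 hA hmono (Finset.Subset.refl {a}) (Finset.Subset.refl {a}) s t)
      (hν0 _) (hν0 _) (hcO0 _) (hcO0 _) (hcO0 _) (hcO0 _) (hvO0 _) (hvO0 _)
  have pNN : ∀ s ⊆ U, ∀ t ⊆ U, ν s * cO s * gO s * (ν t * cO t * gO t) ≤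
      ν (s ∩ t) * cO (s ∩ t) * gO (s ∩ t) * (ν (s ∪ t) * cO (s ∪ t) * gO (s ∪ t)) := by
    intro s hs t ht
    by_cases h0 : ν s = 0
    · rw [h0]; simp only [zero_mul]; exact mul_nonneg (hNw0 _) (hNw0 _)
    by_cases h1 : ν t = 0
    · rw [h1]; simp only [zero_mul, mul_zero]; exact mul_nonneg (hNw0 _) (hNw0 _)
    exact three_step (hν s hs t ht) (open_mul_open_le_of_chain pr und c (hchain s hs t ht h0 h1))
      (sure_mul_sure_le hA0 hA hmono (Finset.Subset.refl {a, w}) (Finset.Subset.refl {a, w}) s t)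
      (hν0 _) (hν0 _) (hcO0 _) (hcO0 _) (hcO0 _) (hcO0 _) (hgO0 _) (hgO0 _)
  have pNL : ∀ s ⊆ U, ∀ t ⊆ U, ν s * cO s * gO s * (ν t * cC t * vC t) ≤
      ν (s ∩ t) * cC (s ∩ t) * vC (s ∩ t) * (ν (s ∪ t) * cO (s ∪ t) * gO (s ∪ t)) := by
    intro s hs t ht
    exact three_step (hν s hs t ht) (open_mul_closed_le' hp0 hp1 und c s t)
      (sure_mul_mixVal_le hp0 hp1 hA0 hA hmono ent' c haw s t) (hν0 _) (hν0 _)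
      (hcO0 _) (hcC0 _) (hcC0 _) (hcO0 _) (hgO0 _) (hvC0 _)
  have pNK : ∀ s ⊆ U, ∀ t ⊆ U, ν s * cO s * gO s * (ν t * cO t * vO t) ≤
      ν (s ∩ t) * cO (s ∩ t) * vO (s ∩ t) * (ν (s ∪ t) * cO (s ∪ t) * gO (s ∪ t)) := by
    intro s hs t ht
    by_cases h0 : ν s = 0
    · rw [h0]; simp only [zero_mul]; exact mul_nonneg (hKw0 _) (hNw0 _)
    by_cases h1 : ν t = 0
    · rw [h1]; simp only [zero_mul, mul_zero]; exact mul_nonneg (hKw0 _) (hNw0 _)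
    exact three_step (hν s hs t ht) (open_mul_open_le_of_chain pr und c (hchain s hs t ht h0 h1))
      (sure_mul_sure_le hA0 hA hmono (Finset.Subset.refl {a}) haw s t) (hν0 _) (hν0 _)
      (hcO0 _) (hcO0 _) (hcO0 _) (hcO0 _) (hgO0 _) (hvO0 _)
  -- the block sums
  set L : Bool → Bool → R :=
    fun b₁ b₂ => ∑ W ∈ U.powerset, ν W * cC W * vC W * cellWt m₁ m₂ b₁ b₂ W with hLdef
  set M : Bool → Bool → R :=
    fun b₁ b₂ => ∑ W ∈ U.powerset, ν W * cC W * gC W * cellWt m₁ m₂ b₁ b₂ W with hMdef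
  set K : Bool → Bool → R :=
    fun b₁ b₂ => ∑ W ∈ U.powerset, ν W * cO W * vO W * cellWt m₁ m₂ b₁ b₂ W with hKdef
  set N : Bool → Bool → R :=
    fun b₁ b₂ => ∑ W ∈ U.powerset, ν W * cO W * gO W * cellWt m₁ m₂ b₁ b₂ W with hNdef
  have hL0 : ∀ b₁ b₂, 0 ≤ L b₁ b₂ := fun b₁ b₂ =>
    Finset.sum_nonneg fun W _ => mul_nonneg (hLw0 W) (cellWt_nonneg _ _ _ _ _)
  have hM0 : ∀ b₁ b₂, 0 ≤ M b₁ b₂ := fun b₁ b₂ =>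
    Finset.sum_nonneg fun W _ => mul_nonneg (hMw0 W) (cellWt_nonneg _ _ _ _ _)
  have hK0 : ∀ b₁ b₂, 0 ≤ K b₁ b₂ := fun b₁ b₂ =>
    Finset.sum_nonneg fun W _ => mul_nonneg (hKw0 W) (cellWt_nonneg _ _ _ _ _)
  have hN0 : ∀ b₁ b₂, 0 ≤ N b₁ b₂ := fun b₁ b₂ =>
    Finset.sum_nonneg fun W _ => mul_nonneg (hNw0 W) (cellWt_nonneg _ _ _ _ _)
  have hML : ∀ b₁ b₂, M b₁ b₂ ≤ L b₁ b₂ := fun b₁ b₂ =>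
    Finset.sum_le_sum fun W _ =>
      mul_le_mul_of_nonneg_right
        (mul_le_mul_of_nonneg_left (hgvC W) (mul_nonneg (hν0 W) (hcC0 W)))
        (cellWt_nonneg _ _ _ _ _)
  -- `M₀₀ = Λ₀₀`: a cluster without markers has no covered entry
  have hzero : M false false = L false false := by
    simp only [hMdef, hLdef]
    refine Finset.sum_congr rfl fun W hW => ?_
    have hWU : W ⊆ U := Finset.mem_powerset.1 hW
    by_cases hc : cellWt (R := R) m₁ m₂ false false W = 0
    · rw [hc, mul_zero, mul_zero]
    · obtain ⟨h1, h2⟩ := of_cellWt_ne_zero hc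
      have hm1 : m₁ ∉ W := fun h => Bool.false_ne_true (h1.1 h)
      have hm2 : m₂ ∉ W := fun h => Bool.false_ne_true (h2.1 h)
      by_cases he : ∃ r ∈ ent', r ∈ W
      · rw [hcov W hWU hm1 hm2 he]
        simp only [zero_mul]
      · have he' : ∀ r ∈ ent', r ∉ W := fun r hr hrW => he ⟨r, hr, hrW⟩
        simp only [hgC, hvC]
        rw [gValK_eq_rValK_of_no_entry A pr c a w he']
  -- the block relations by Ahlswede–Daykin
  have H1 : L true false * L false true ≤ L false false * L true true := by
    have := cellBlock_mul_le U (fun W => ν W * cC W * vC W) (fun W => ν W * cC W * vC W)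
      (fun W => ν W * cC W * vC W) (fun W => ν W * cC W * vC W) m₁ m₂ true false false true
      hLw0 hLw0 hLw0 hLw0 pLL
    simpa only [Bool.true_and, Bool.and_true, Bool.false_or, Bool.or_false] using this
  have H2 : M true false * M false true ≤ L false false * M true true := by
    have := cellBlock_mul_le U (fun W => ν W * cC W * gC W) (fun W => ν W * cC W * gC W)
      (fun W => ν W * cC W * vC W) (fun W => ν W * cC W * gC W) m₁ m₂ true false false true
      hMw0 hMw0 hLw0 hMw0 pMM
    simpa only [Bool.true_and, Bool.and_true, Bool.false_or, Bool.or_false] using this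
  have X1a : L true false * K false true ≤ L false false * K true true := by
    have := cellBlock_mul_le U (fun W => ν W * cC W * vC W) (fun W => ν W * cO W * vO W)
      (fun W => ν W * cC W * vC W) (fun W => ν W * cO W * vO W) m₁ m₂ true false false true
      hLw0 hKw0 hLw0 hKw0 pLK
    simpa only [Bool.true_and, Bool.and_true, Bool.false_or, Bool.or_false] using this
  have X1b : L false true * K true false ≤ L false false * K true true := by
    have := cellBlock_mul_le U (fun W => ν W * cC W * vC W) (fun W => ν W * cO W * vO W)
      (fun W => ν W * cC W * vC W) (fun W => ν W * cO W * vO W) m₁ m₂ false true true false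
      hLw0 hKw0 hLw0 hKw0 pLK
    simpa only [Bool.true_and, Bool.and_true, Bool.false_or, Bool.or_false, Bool.false_and,
      Bool.and_false, Bool.true_or, Bool.or_true] using this
  have X2a : L true false * K false false ≤ L false false * K true false := by
    have := cellBlock_mul_le U (fun W => ν W * cC W * vC W) (fun W => ν W * cO W * vO W)
      (fun W => ν W * cC W * vC W) (fun W => ν W * cO W * vO W) m₁ m₂ true false false false
      hLw0 hKw0 hLw0 hKw0 pLK
    simpa only [Bool.true_and, Bool.and_true, Bool.false_or, Bool.or_false, Bool.false_and,
      Bool.and_false, Bool.true_or, Bool.or_true] using this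
  have X2b : L false true * K false false ≤ L false false * K false true := by
    have := cellBlock_mul_le U (fun W => ν W * cC W * vC W) (fun W => ν W * cO W * vO W)
      (fun W => ν W * cC W * vC W) (fun W => ν W * cO W * vO W) m₁ m₂ false true false false
      hLw0 hKw0 hLw0 hKw0 pLK
    simpa only [Bool.true_and, Bool.and_true, Bool.false_or, Bool.or_false, Bool.false_and,
      Bool.and_false, Bool.true_or, Bool.or_true] using this
  have H1K : K true false * K false true ≤ K false false * K true true := by
    have := cellBlock_mul_le U (fun W => ν W * cO W * vO W) (fun W => ν W * cO W * vO W)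
      (fun W => ν W * cO W * vO W) (fun W => ν W * cO W * vO W) m₁ m₂ true false false true
      hKw0 hKw0 hKw0 hKw0 pKK
    simpa only [Bool.true_and, Bool.and_true, Bool.false_or, Bool.or_false] using this
  have H2N : N true false * N false true ≤ N false false * N true true := by
    have := cellBlock_mul_le U (fun W => ν W * cO W * gO W) (fun W => ν W * cO W * gO W)
      (fun W => ν W * cO W * gO W) (fun W => ν W * cO W * gO W) m₁ m₂ true false false true
      hNw0 hNw0 hNw0 hNw0 pNN
    simpa only [Bool.true_and, Bool.and_true, Bool.false_or, Bool.or_false] using this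
  -- the Holley relations `N ≽ L` and `N ≽ K`, for any two blocks
  have holNL : ∀ b₁ b₂ b₁' b₂' : Bool, N b₁ b₂ * L b₁' b₂' ≤
      L (b₁ && b₁') (b₂ && b₂') * N (b₁ || b₁') (b₂ || b₂') := fun b₁ b₂ b₁' b₂' =>
    cellBlock_mul_le U (fun W => ν W * cO W * gO W) (fun W => ν W * cC W * vC W)
      (fun W => ν W * cC W * vC W) (fun W => ν W * cO W * gO W) m₁ m₂ b₁ b₂ b₁' b₂'
      hNw0 hLw0 hLw0 hNw0 pNL
  have holNK : ∀ b₁ b₂ b₁' b₂' : Bool, N b₁ b₂ * K b₁' b₂' ≤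
      K (b₁ && b₁') (b₂ && b₂') * N (b₁ || b₁') (b₂ || b₂') := fun b₁ b₂ b₁' b₂' =>
    cellBlock_mul_le U (fun W => ν W * cO W * gO W) (fun W => ν W * cO W * vO W)
      (fun W => ν W * cO W * vO W) (fun W => ν W * cO W * gO W) m₁ m₂ b₁ b₂ b₁' b₂'
      hNw0 hKw0 hKw0 hNw0 pNK
  -- the two marker shifts of `N` over `L` and over `K`
  have dNL1 := holleyBlock_D_nonneg (L false false) (L false true) (L true false) (L true true)
    (N false false) (N false true) (N true false) (N true true) (hL0 _ _) (hL0 _ _) (hL0 _ _)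
    (hL0 _ _) (hN0 _ _) H1
    (by simpa using holNL false false true false) (by simpa using holNL false true true true)
    (by simpa using holNL false false true true) (by simpa using holNL false true true false)
  have dNL2 := holleyBlock_D_nonneg (L false false) (L true false) (L false true) (L true true)
    (N false false) (N true false) (N false true) (N true true) (hL0 _ _) (hL0 _ _) (hL0 _ _)
    (hL0 _ _) (hN0 _ _) (by linarith [H1])
    (by simpa using holNL false false false true) (by simpa using holNL true false true true)
    (by simpa using holNL false false true true) (by simpa using holNL true false false true)
  have dNK1 := holleyBlock_D_nonneg (K false false) (K false true) (K true false) (K true true)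
    (N false false) (N false true) (N true false) (N true true) (hK0 _ _) (hK0 _ _) (hK0 _ _)
    (hK0 _ _) (hN0 _ _) H1K
    (by simpa using holNK false false true false) (by simpa using holNK false true true true)
    (by simpa using holNK false false true true) (by simpa using holNK false true true false)
  have dNK2 := holleyBlock_D_nonneg (K false false) (K true false) (K false true) (K true true)
    (N false false) (N true false) (N false true) (N true true) (hK0 _ _) (hK0 _ _) (hK0 _ _)
    (hK0 _ _) (hN0 _ _) (by linarith [H1K])
    (by simpa using holNK false false false true) (by simpa using holNK true false true true)
    (by simpa using holNK false false true true) (by simpa using holNK true false false true)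
  -- split the fourteen sums into blocks
  have eΛc := sum_split_four U (fun W => ν W * cC W * vC W) m₁ m₂
  have eΛo := sum_split_four U (fun W => ν W * cO W * vO W) m₁ m₂
  have eF1c := sum_split_fst U (fun W => ν W * cC W * vC W) m₁ m₂
  have eF1o := sum_split_fst U (fun W => ν W * cO W * vO W) m₁ m₂
  have eF2c := sum_split_snd U (fun W => ν W * cC W * vC W) m₁ m₂
  have eF2o := sum_split_snd U (fun W => ν W * cO W * vO W) m₁ m₂
  have eMc := sum_split_four U (fun W => ν W * cC W * gC W) m₁ m₂
  have eMo := sum_split_four U (fun W => ν W * cO W * gO W) m₁ m₂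
  have eXc := sum_split_fst U (fun W => ν W * cC W * gC W) m₁ m₂
  have eXo := sum_split_fst U (fun W => ν W * cO W * gO W) m₁ m₂
  have eYc := sum_split_snd U (fun W => ν W * cC W * gC W) m₁ m₂
  have eYo := sum_split_snd U (fun W => ν W * cO W * gO W) m₁ m₂
  have eXYc := sum_split_both U (fun W => ν W * cC W * gC W) m₁ m₂
  have eXYo := sum_split_both U (fun W => ν W * cO W * gO W) m₁ m₂
  rw [eΛc, eΛo, eF1c, eF1o, eF2c, eF2o, eMc, eMo, eXc, eXo, eYc, eYo, eXYc, eXYo]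
  -- the mixed block theorem
  have hD1 : (L true false + L true true + (K true false + K true true)) *
      (N false false + N false true + N true false + N true true) ≤
      (L false false + L false true + L true false + L true true +
        (K false false + K false true + K true false + K true true)) *
        (N true false + N true true) := by
    linarith [dNL1, dNK1]
  have hD2 : (L false true + L true true + (K false true + K true true)) *
      (N false false + N false true + N true false + N true true) ≤
      (L false false + L false true + L true false + L true true +
        (K false false + K false true + K true false + K true true)) *
        (N false true + N true true) := by
    linarith [dNL2, dNK2]
  have key := mixBlock_nonneg (L false false) (L false true) (L true false) (L true true)
    (M false false) (M false true) (M true false) (M true true)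
    (K false false) (K false true) (K true false) (K true true)
    (N false false) (N false true) (N true false) (N true true)
    (hL0 _ _) (hL0 _ _) (hL0 _ _) (hL0 _ _) (hK0 _ _) (hK0 _ _) (hK0 _ _) (hK0 _ _)
    (hM0 _ _) (hM0 _ _) (hM0 _ _) (hN0 _ _) (hN0 _ _) (hN0 _ _) (hN0 _ _)
    (hML _ _) (hML _ _) hzero H1 H2 X1a X1b X2a X2b H2N hD1 hD2
  simp only [hLdef, hMdef, hKdef, hNdef] at key
  exact key

end KOneFunctional

end Summit.Ventures.PercRepro2.Coin
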